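import Summits.ResolutionOfSingularities.ResolutionOfSingularities.Theorems.FrobeniusClosingPatchingRelPerfectDepthOneDictionaryStep
import Summits.ResolutionOfSingularities.ResolutionOfSingularities.Theorems.FrobeniusClosingPatchingRelPerfectDepthOneBlowupDimension
import Summits.ResolutionOfSingularities.ResolutionOfSingularities.Theorems.FrobeniusClosingPatchingRelPerfectDepthOneExceptionalDivisor
import Literature.AlgebraicGeometry.Resolution.ExceptionalDivisorProjectiveBundle
import Literature.AlgebraicGeometry.Resolution.AlterationsBoundarySmoothLocus
import Literature.AlgebraicGeometry.Resolution.SNCStrataSmooth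
import Literature.AlgebraicGeometry.Resolution.BlowupReducedDimension
import Literature.AlgebraicGeometry.Resolution.BlowupChartMembership
import Literature.AlgebraicGeometry.Resolution.BlowupsIntegral
import Literature.AlgebraicGeometry.Motives.SubschemeCyclesRatLocalProofs
import HarnessLib

/-!
# Chain W5.2, rung R4 — the ESCAPED-CARRIER PACKAGE («I1 for carriers»)

[OURS · L1 W5.2 · R4 support] Crux `PatchingRelPerfect` (stmt-ResolutionOfSingularities-16161), line
`closed_point_slice`; res-L1-w52-plan-1 STEER (TargetsF3) (k): the input of every weight-deficient step (D1^{ℓ,ν}) in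
R4 — «the cosupport that escapes the retract-open along a weight-ν exceptional carrier F is a problem of smaller
depth ℓ − ν on the regular threefold F (over the closed point, l.f.t. over κ)» (KERNEL NOTE v1.6).

SETTING (the X-side data of `DepthTargets.DepthInvariant` / `DepthInvariantMono`, unbundled): `S` regular local;
`g : X ⟶ Spec S` a blowing up along an ideal sheaf cosupported in the closed point, `X` Noetherian (and regular);
`i : E ⟶ X` a closed immersion (with `E` regular, `𝓘_E = i.ker` an effective Cartier divisor) such that `E`
CONTAINS THE SCHEME-THEORETIC CLOSED FIBRE: `𝔪𝒪_X ≤ 𝓘_E` (`h𝔪E`; true at the initial state `E = V(𝔪𝒪_{X₁})` and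
propagated along every step, `comap_maximalIdeal_le_ker_strictTransform`); a centre `C` on `E` with `V(C)` regular;
`σ : X' ⟶ X` a blowing up along `Ĉ = C.map i`. THE CARRIER is the exceptional divisor of `σ`,
`F := V(Ĉ𝒪_{X'}) = ((C.map i).comap σ).subscheme`, `ι_F` its closed immersion.

RESULTS (all fact-free):
* `isNoetherian_carrier` — `F` Noetherian (as is `X'`, tree `isNoetherian_of_isBlowup`);
* `isRegular_carrier` — `F` regular (Liu 8.1.19 (b), tree `IsBlowup.isRegular_subscheme_comap`);
* `ker_carrierι`, `isEffectiveCartier_ker_carrier` — `𝓘_F = Ĉ𝒪_{X'}` is an effective Cartier divisor;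
* `comap_maximalIdeal_carrier_eq_bot`, `exists_hom_carrier_residueField`, `locallyOfFiniteType_of_fac_carrier`
  — `F` is a scheme LOCALLY OF FINITE TYPE OVER THE RESIDUE FIELD `κ` compatibly with `F → X' → X → Spec S`;
* `map_carrier_eq_closedPoint` — `F` lies over the closed point;
* `isExcellent_carrier` — `F` is excellent (finite type over a field; no excellence of `S`);
* `comap_maximalIdeal_le_ker_strictTransform` — the hypothesis `𝔪𝒪 ≤ 𝓘_E` PROPAGATES to the strict transform;
* `topologicalKrullDim_le_of_isBlowup_spec` — `dim X ≤ dim S`; `ringKrullDim_stalk_carrier_add_one` —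
  `dim 𝒪_{F,f} + 1 = dim 𝒪_{X',f}`; `topologicalKrullDim_carrier_le` — `dim F ≤ 3` when `dim S = 4`;
* **`topologicalKrullDim_carrier`** — `dim F = 3` when `dim S = 4`, `E` is integral of dimension `3`, `𝓘_E` is
  effective Cartier and `⊥ ≠ C ≠ ⊤` (through the strict transform `E'` of `E`: a closed point `e' ∈ E'` over `V(C)`
  has `dim 𝒪_{E',e'} = 3` — `E'` is integral of finite type over `κ` — and `𝒪_{E',e'}` is a quotient of
  `𝒪_{X',e'}/(t)`, `t` a local equation of `σ^*E`, so `dim 𝒪_{X',e'} = 4` and `dim 𝒪_{F,e'} = 3`).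

NOT INCLUDED: integrality of `F` (true iff `V(C)` is irreducible; `F → V(Ĉ)` is a projective bundle) — the consumer
splits the regular `F` into its integral connected components or the E-side delivers irreducible centres. NOT a
statement of the manuscript under review. AI-written; weaker than expert review.

## References
* Q. Liu, *Algebraic Geometry and Arithmetic Curves* (2002), Thm. 8.1.19 (a), (b). [Liu2002]
* U. Görtz, T. Wedhorn, *Algebraic Geometry I*, 2nd ed. (2020), Lemma 5.7, Thm. 5.22, Prop. 13.91. [GortzWedhorn2020]
* A. Grothendieck, EGA IV₂, Prop. 7.8.6 (i). [EGAIV2]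
* The Stacks Project, Tags 00KW, 080A, 0804. [StacksProject]
-/
-- `Summit.<Summit>.<Sub>.Theorems` with `Sub = Summit` (single-conjunct summit, D-0017)
set_option linter.dupNamespace false

noncomputable section

open CategoryTheory CategoryTheory.Limits AlgebraicGeometry TopologicalSpace
open Literature.AlgebraicGeometry.Resolution
open IsLocalRing

namespace Summit.ResolutionOfSingularities.ResolutionOfSingularities.Theorems.DepthTargets

universe u

/-! ## §0 Two generalities -/
/-- `d + 1 = b` and `m ≤ d` in `WithBot ℕ∞` give `m + 1 ≤ b` for naturals `b, m`. [folklore] -/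
theorem nat_succ_le_of_add_one_eq {d : WithBot ℕ∞} {b m : ℕ} (h : d + 1 = (b : WithBot ℕ∞))
    (hm : (m : WithBot ℕ∞) ≤ d) : m + 1 ≤ b := by
  induction d using WithBot.recBotCoe with
  | bot => exact absurd h (by simp)
  | coe d =>
    induction d using ENat.recTopCoe with
    | top =>
      exfalso
      have h' : ((⊤ : ℕ∞) : WithBot ℕ∞) + ((1 : ℕ∞) : WithBot ℕ∞) = ((b : ℕ∞) : WithBot ℕ∞) := h
      rw [← WithBot.coe_add, WithBot.coe_inj] at h'
      simp at h'
    | coe n =>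
      have h1 : n + 1 = b := by exact_mod_cast h
      have h2 : m ≤ n := by exact_mod_cast hm
      omega

/-- **The dimension of the local ring of an effective Cartier divisor**: `dim 𝒪_{V(J),c} + 1 = dim 𝒪_{X,c}` (the
stalk `J_c = (t)` with `t` a nonzerodivisor in the maximal ideal). [cite: StacksProject, Tag 00KW] -/
theorem ringKrullDim_stalk_subscheme_add_one {X : Scheme.{u}} [IsLocallyNoetherian X] {J : X.IdealSheafData}
    (hJ : IsEffectiveCartier J) (c : J.subscheme) :
    ringKrullDim (J.subscheme.presheaf.stalk c) + 1 = ringKrullDim (X.presheaf.stalk (J.subschemeι c)) := by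
  rw [ringKrullDim_stalk_subscheme J c]
  obtain ⟨t, ht, hJt⟩ := hJ.exists_stalkIdeal_eq_span (J.subschemeι c)
  rw [hJt]
  apply ringKrullDim_quotient_span_singleton_succ_eq_ringKrullDim_of_mem_nonZeroDivisors ht
  have hmem : (J.subschemeι c : X) ∈ (J.support : Set X) := by
    rw [← Scheme.IdealSheafData.range_subschemeι]; exact ⟨c, rfl⟩
  have hle := (mem_support_iff_stalkIdeal_le J _).mp hmem
  rw [hJt] at hle
  exact hle (Ideal.mem_span_singleton_self t)

/-- `dim X ≤ dim S` for a blowing up `g : X ⟶ Spec S` of a Noetherian ring `S` of dimension `n`.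
[cite: GortzWedhorn2020, Lemma 5.7] -/
theorem topologicalKrullDim_le_of_isBlowup_spec {S : Type u} [CommRing S] [IsNoetherianRing S] {n : ℕ}
    (hS : ringKrullDim S = n) {X : Scheme.{u}} {g : X ⟶ Spec (.of S)} {K₀ : (Spec (.of S)).IdealSheafData}
    (hg : IsBlowup g K₀) : topologicalKrullDim X ≤ n := by
  haveI : AlgebraicGeometry.IsNoetherian (Spec (.of S)) := {}
  refine hg.topologicalKrullDim_le_of_isLocallyNoetherian ?_
  have h : topologicalKrullDim (Spec (.of S)) = ringKrullDim S := PrimeSpectrum.topologicalKrullDim_eq_ringKrullDim S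
  rw [h, hS]

/-! ## §1 The carrier: Noetherian, regular, Cartier, over the residue field, excellent -/
section Carrier
variable {S : Type u} [CommRing S] [IsRegularLocalRing S]
  {E X X' : Scheme.{u}} (i : E ⟶ X) (g : X ⟶ Spec (.of S))
  (C : E.IdealSheafData) (σ : X' ⟶ X) (hσ : IsBlowup σ (C.map i))

local notation3 "𝓕" => ((Scheme.IdealSheafData.map C i).comap σ)
local notation3 "𝔪~" => affineBlowup.idealSheaf (IsLocalRing.maximalIdeal S)

include hσ in
/-- **The carrier `F = V(Ĉ𝒪_{X'})` is Noetherian.** [cite: StacksProject, Tag 0804] -/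
theorem isNoetherian_carrier [AlgebraicGeometry.IsNoetherian X] : AlgebraicGeometry.IsNoetherian (𝓕).subscheme := by
  haveI := isNoetherian_of_isBlowup hσ
  haveI : IsLocallyNoetherian (𝓕).subscheme := LocallyOfFiniteType.isLocallyNoetherian (𝓕).subschemeι
  haveI : CompactSpace (𝓕).subscheme := QuasiCompact.compactSpace_of_compactSpace (𝓕).subschemeι
  exact {}

include hσ in
/-- **The carrier is regular** (Liu Thm. 8.1.19 (b): the exceptional divisor of the blowing up of the regular
`X` along the regular centre `V(Ĉ) ≅ V(C)`). [cite: Liu2002, Thm. 8.1.19 (b)] -/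
theorem isRegular_carrier [AlgebraicGeometry.IsNoetherian X] [IsClosedImmersion i] (hX : Scheme.IsRegular X)
    (hC : Scheme.IsRegular C.subscheme) : Scheme.IsRegular (𝓕).subscheme :=
  hσ.isRegular_subscheme_comap hX (DepthOne.isRegular_subscheme_map i C hC)

/-- The ideal of the carrier is `Ĉ𝒪_{X'}`. [folklore] -/
theorem ker_carrierι : (𝓕).subschemeι.ker = 𝓕 :=
  Scheme.IdealSheafData.ker_subschemeι _

include hσ in
/-- **`𝓘_F` is an effective Cartier divisor** (the exceptional divisor of a blowing up). [cite: GortzWedhorn2020, Prop. 13.91] -/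
theorem isEffectiveCartier_ker_carrier : IsEffectiveCartier (𝓕).subschemeι.ker := by
  rw [ker_carrierι]; exact hσ.isEffectiveCartier

/-- `𝔪𝒪_F = 0`: the carrier lies in the scheme-theoretic closed fibre, provided `E` does (`𝔪𝒪_X ≤ 𝓘_E`):
`𝔪𝒪_{X'} ≤ 𝓘_E𝒪_{X'} ≤ Ĉ𝒪_{X'} = 𝓘_F`. [folklore] -/
theorem comap_maximalIdeal_carrier_eq_bot (h𝔪E : (𝔪~).comap g ≤ i.ker) :
    (𝔪~).comap ((𝓕).subschemeι ≫ σ ≫ g) = ⊥ := by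
  rw [Scheme.IdealSheafData.comap_comp, Scheme.IdealSheafData.comap_comp]
  apply le_bot_iff.mp
  calc (((𝔪~).comap g).comap σ).comap (𝓕).subschemeι
      ≤ ((i.ker.comap σ)).comap (𝓕).subschemeι :=
        Scheme.IdealSheafData.comap_mono _ (Scheme.IdealSheafData.comap_mono _ h𝔪E)
    _ ≤ (𝓕).comap (𝓕).subschemeι :=
        Scheme.IdealSheafData.comap_mono _ (Scheme.IdealSheafData.comap_mono _ (DepthOne.ker_le_map_centre i C))
    _ = ⊥ := comap_subschemeι_self _

/-- **The carrier is a scheme over the residue field**, compatibly with `F → X' → X → Spec S`. [folklore] -/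
theorem exists_hom_carrier_residueField (h𝔪E : (𝔪~).comap g ≤ i.ker) :
    ∃ q : (𝓕).subscheme ⟶ Spec (.of (IsLocalRing.ResidueField S)),
      q ≫ Spec.map (CommRingCat.ofHom (IsLocalRing.residue S)) = (𝓕).subschemeι ≫ σ ≫ g := by
  have hker : (Spec.map (CommRingCat.ofHom (IsLocalRing.residue S))).ker ≤ ((𝓕).subschemeι ≫ σ ≫ g).ker := by
    rw [ker_specMap_eq_idealSheaf, IsLocalRing.ker_residue, le_ker_iff_comap_eq_bot]
    exact comap_maximalIdeal_carrier_eq_bot i g C σ h𝔪E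
  haveI : IsClosedImmersion (Spec.map (CommRingCat.ofHom (IsLocalRing.residue S))) :=
    IsClosedImmersion.spec_of_surjective _ IsLocalRing.residue_surjective
  exact ⟨IsClosedImmersion.lift _ _ hker, IsClosedImmersion.lift_fac _ _ hker⟩

include hσ in
/-- A morphism `q : F ⟶ Spec κ` through which `F → X' → X → Spec S` factors is locally of finite type
(`g`, `σ` blowings up of Noetherian schemes — proper —, `ι_F` a closed immersion). [folklore] -/
theorem locallyOfFiniteType_of_fac_carrier [AlgebraicGeometry.IsNoetherian X]
    (hg : ∃ K₀ : (Spec (.of S)).IdealSheafData, IsBlowup g K₀ ∧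
      (K₀.support : Set (Spec (.of S))) ⊆ {IsLocalRing.closedPoint S})
    {q : (𝓕).subscheme ⟶ Spec (.of (IsLocalRing.ResidueField S))}
    (hq : q ≫ Spec.map (CommRingCat.ofHom (IsLocalRing.residue S)) = (𝓕).subschemeι ≫ σ ≫ g) :
    LocallyOfFiniteType q := by
  obtain ⟨K₀, hgK, -⟩ := hg
  haveI : AlgebraicGeometry.IsNoetherian (Spec (.of S)) := {}
  haveI : IsProper g := hgK.isProper
  haveI : IsProper σ := hσ.isProper
  haveI : LocallyOfFiniteType ((𝓕).subschemeι ≫ σ ≫ g) := inferInstance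
  haveI : LocallyOfFiniteType (q ≫ Spec.map (CommRingCat.ofHom (IsLocalRing.residue S))) := by
    rw [hq]; infer_instance
  exact locallyOfFiniteType_of_comp q (Spec.map (CommRingCat.ofHom (IsLocalRing.residue S)))

/-- **The carrier lies over the closed point** (set-theoretically). [folklore] -/
theorem map_carrier_eq_closedPoint (h𝔪E : (𝔪~).comap g ≤ i.ker) (f : ↥((𝓕).subscheme)) :
    ((𝓕).subschemeι ≫ σ ≫ g).base f = IsLocalRing.closedPoint S := by
  have h := comap_maximalIdeal_carrier_eq_bot i g C σ h𝔪E
  have hf : f ∈ ((((𝔪~).comap ((𝓕).subschemeι ≫ σ ≫ g))).support : Set _) := by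
    rw [h, Scheme.IdealSheafData.support_bot]; trivial
  rw [Scheme.IdealSheafData.support_comap, Closeds.coe_preimage] at hf
  exact support_idealSheaf_subset_closedPoint (Q := IsLocalRing.maximalIdeal S) (n := 1) (by rw [pow_one]) _ hf

include hσ in
/-- **The carrier is excellent**: of finite type over the field `κ` (EGA IV 7.8.6; no excellence of `S` is used).
[cite: EGAIV2, Prop. 7.8.6 (i)] -/
theorem isExcellent_carrier [AlgebraicGeometry.IsNoetherian X] (h𝔪E : (𝔪~).comap g ≤ i.ker)
    (hg : ∃ K₀ : (Spec (.of S)).IdealSheafData, IsBlowup g K₀ ∧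
      (K₀.support : Set (Spec (.of S))) ⊆ {IsLocalRing.closedPoint S}) :
    Scheme.IsExcellent (𝓕).subscheme := by
  obtain ⟨q, hq⟩ := exists_hom_carrier_residueField i g C σ h𝔪E
  haveI := locallyOfFiniteType_of_fac_carrier i g C σ hσ hg hq
  haveI := isNoetherian_carrier i C σ hσ
  exact Scheme.IsExcellent.of_locallyOfFiniteType q
    (Scheme.isExcellent_Spec_of_isExcellentRing _ (isExcellentRing_of_field _))

/-! ## §2 Propagation of `𝔪𝒪 ≤ 𝓘_E` to the strict transform -/
/-- **`𝔪𝒪_X ≤ 𝓘_E` propagates**: for any `i' : E' ⟶ X'` and `τ : E' ⟶ E` with `i' ≫ σ = τ ≫ i` (the strict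
transform of `E`), `𝔪𝒪_{X'} ≤ σ^*𝓘_E ≤ 𝓘_{E'}`. [folklore] -/
theorem comap_maximalIdeal_le_ker_strictTransform (h𝔪E : (𝔪~).comap g ≤ i.ker) {E' : Scheme.{u}}
    (i' : E' ⟶ X') (τ : E' ⟶ E) (hsq : i' ≫ σ = τ ≫ i) : (𝔪~).comap (σ ≫ g) ≤ i'.ker := by
  rw [Scheme.IdealSheafData.comap_comp]
  refine (Scheme.IdealSheafData.comap_mono σ h𝔪E).trans ?_
  rw [le_ker_iff_comap_eq_bot, ← Scheme.IdealSheafData.comap_comp, hsq, Scheme.IdealSheafData.comap_comp,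
    comap_ker_self, comap_bot]

/-- `σ^*𝓘_E ≤ 𝓘_{E'}` for the strict transform. [folklore] -/
theorem comap_ker_le_ker_strictTransform {E' : Scheme.{u}} (i' : E' ⟶ X') (τ : E' ⟶ E)
    (hsq : i' ≫ σ = τ ≫ i) : i.ker.comap σ ≤ i'.ker := by
  rw [le_ker_iff_comap_eq_bot, ← Scheme.IdealSheafData.comap_comp, hsq, Scheme.IdealSheafData.comap_comp,
    comap_ker_self, comap_bot]

/-! ## §3 Dimension -/
include hσ in
/-- **`dim 𝒪_{F,f} + 1 = dim 𝒪_{X',f}`** (`𝓘_F` is an effective Cartier divisor). [cite: StacksProject, Tag 00KW] -/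
theorem ringKrullDim_stalk_carrier_add_one [AlgebraicGeometry.IsNoetherian X] (f : ↥((𝓕).subscheme)) :
    ringKrullDim (((𝓕).subscheme).presheaf.stalk f) + 1 =
      ringKrullDim (X'.presheaf.stalk ((𝓕).subschemeι f)) := by
  haveI := isNoetherian_of_isBlowup hσ
  exact ringKrullDim_stalk_subscheme_add_one hσ.isEffectiveCartier f

include hσ in
/-- **`dim F ≤ 3` when `dim S = 4`**: `dim X' ≤ dim X ≤ dim S = 4` (blowing up does not raise the dimension of
a Noetherian scheme) and every local ring of the Cartier divisor `F` has dimension one less than that of `X'`.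
[cite: GortzWedhorn2020, Lemma 5.7] -/
theorem topologicalKrullDim_carrier_le [AlgebraicGeometry.IsNoetherian X] (hdim : ringKrullDim S = (4 : ℕ))
    (hg : ∃ K₀ : (Spec (.of S)).IdealSheafData, IsBlowup g K₀ ∧
      (K₀.support : Set (Spec (.of S))) ⊆ {IsLocalRing.closedPoint S}) :
    topologicalKrullDim (𝓕).subscheme ≤ 3 := by
  obtain ⟨K₀, hgK, -⟩ := hg
  haveI := isNoetherian_of_isBlowup hσ
  have hX : topologicalKrullDim X ≤ (4 : ℕ) := topologicalKrullDim_le_of_isBlowup_spec hdim hgK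
  have hX' : topologicalKrullDim X' ≤ (4 : ℕ) := hσ.topologicalKrullDim_le_of_isLocallyNoetherian hX
  haveI := isNoetherian_carrier i C σ hσ
  rw [Literature.AlgebraicGeometry.Motives.Scheme.topologicalKrullDim_eq_iSup_ringKrullDim_stalk]
  refine iSup_le fun f => ?_
  obtain ⟨a, ha⟩ :=
    Literature.AlgebraicGeometry.Motives.exists_ringKrullDim_eq_nat (((𝓕).subscheme).presheaf.stalk f)
  obtain ⟨b, hb⟩ :=
    Literature.AlgebraicGeometry.Motives.exists_ringKrullDim_eq_nat (X'.presheaf.stalk ((𝓕).subschemeι f))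
  have h1 := ringKrullDim_stalk_carrier_add_one i C σ hσ f
  have h2 : ringKrullDim (X'.presheaf.stalk ((𝓕).subschemeι f)) ≤ (4 : ℕ) :=
    (ringKrullDim_stalk_le_topologicalKrullDim X' _).trans hX'
  rw [ha, hb] at h1; rw [hb] at h2; rw [ha]
  have h1' : a + 1 = b := by exact_mod_cast h1
  have h2' : b ≤ 4 := by exact_mod_cast h2
  have : a ≤ 3 := by omega
  exact_mod_cast this

include hσ in
/-- **`dim F = 3`.** `S` regular local of dimension `4`; `E` integral of dimension `3` with `𝓘_E` effective
Cartier and `𝔪𝒪_X ≤ 𝓘_E`; `⊥ ≠ C ≠ ⊤`; `τ : E' ⟶ E` a blowing up along `C` (the E-side step). A closed point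
`e'` of `E'` over `V(C)` has `dim 𝒪_{E',e'} = 3` (`E'` integral, of finite type over `κ`, of dimension `3`); its
image `x' ∈ F` has `dim 𝒪_{X',x'} ≥ dim 𝒪_{E',e'} + 1 = 4` because `𝒪_{E',e'}` is a quotient of
`𝒪_{X',x'}/(t)`, `t` a local equation of the effective Cartier divisor `σ^*E ⊆ E' ∪ F`; with `dim X' ≤ 4` this
gives `dim 𝒪_{F,x'} = 3`, whence `dim F ≥ 3`. [cite: GortzWedhorn2020, Thm. 5.22] [cite: StacksProject, Tag 00KW] -/
theorem topologicalKrullDim_carrier [AlgebraicGeometry.IsNoetherian X] [IsClosedImmersion i]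
    (hdim : ringKrullDim S = (4 : ℕ))
    (hg : ∃ K₀ : (Spec (.of S)).IdealSheafData, IsBlowup g K₀ ∧
      (K₀.support : Set (Spec (.of S))) ⊆ {IsLocalRing.closedPoint S})
    (h𝔪E : (𝔪~).comap g ≤ i.ker) (hiE : IsEffectiveCartier i.ker) [IsIntegral E]
    (hdimE : topologicalKrullDim E = 3) (hC0 : C ≠ ⊥) (hC1 : C ≠ ⊤)
    {E' : Scheme.{u}} {τ : E' ⟶ E} (hτ : IsBlowup τ C) :
    topologicalKrullDim (𝓕).subscheme = 3 := by
  refine le_antisymm (topologicalKrullDim_carrier_le i g C σ hσ hdim hg) ?_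
  obtain ⟨K₀, hgK, -⟩ := hg
  haveI : AlgebraicGeometry.IsNoetherian (Spec (.of S)) := {}
  haveI := isNoetherian_of_isBlowup hσ
  haveI : IsLocallyNoetherian E := LocallyOfFiniteType.isLocallyNoetherian i
  haveI : CompactSpace E := QuasiCompact.compactSpace_of_compactSpace i
  haveI : AlgebraicGeometry.IsNoetherian E := {}
  haveI : AlgebraicGeometry.IsNoetherian E' := isNoetherian_of_isBlowup hτ
  -- `E` and `E'` over the residue field, of finite type
  have h𝔪Ei : (𝔪~).comap (i ≫ g) = ⊥ := by
    rw [Scheme.IdealSheafData.comap_comp]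
    exact le_bot_iff.mp ((Scheme.IdealSheafData.comap_mono i h𝔪E).trans (comap_ker_self i).le)
  have hkerE : (Spec.map (CommRingCat.ofHom (IsLocalRing.residue S))).ker ≤ (i ≫ g).ker := by
    rw [ker_specMap_eq_idealSheaf, IsLocalRing.ker_residue, le_ker_iff_comap_eq_bot]; exact h𝔪Ei
  haveI : IsClosedImmersion (Spec.map (CommRingCat.ofHom (IsLocalRing.residue S))) :=
    IsClosedImmersion.spec_of_surjective _ IsLocalRing.residue_surjective
  set qE : E ⟶ Spec (.of (IsLocalRing.ResidueField S)) := IsClosedImmersion.lift _ _ hkerE with hqE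
  have hqEfac : qE ≫ Spec.map (CommRingCat.ofHom (IsLocalRing.residue S)) = i ≫ g :=
    IsClosedImmersion.lift_fac _ _ hkerE
  haveI : IsProper g := hgK.isProper
  haveI : LocallyOfFiniteType (qE ≫ Spec.map (CommRingCat.ofHom (IsLocalRing.residue S))) := by
    rw [hqEfac]; infer_instance
  haveI : LocallyOfFiniteType qE :=
    locallyOfFiniteType_of_comp qE (Spec.map (CommRingCat.ofHom (IsLocalRing.residue S)))
  haveI : IsProper τ := hτ.isProper
  haveI : LocallyOfFiniteType (τ ≫ qE) := inferInstance
  -- `E'` integral of dimension `3`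
  haveI : IsIntegral E' := hτ.isIntegral hC0
  have hdimE' : topologicalKrullDim E' = (3 : ℕ) := DepthOne.topologicalKrullDim_eq_of_isBlowup hτ hC0 hdimE
  -- a closed point `e'` of `E'` over `V(C)`
  have hne : ((C.comap τ).support : Set E').Nonempty := by
    rw [Scheme.IdealSheafData.support_comap, Closeds.coe_preimage]
    have hCne : (C.support : Set E).Nonempty := by
      rw [Set.nonempty_iff_ne_empty]
      intro h
      apply hC1
      rw [← Scheme.IdealSheafData.support_eq_bot_iff]
      exact Closeds.ext h
    obtain ⟨e, he⟩ := hCne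
    obtain ⟨e', he'⟩ := DepthOne.surjective_of_isBlowup hτ hC0 e
    exact ⟨e', by rw [Set.mem_preimage, he']; exact he⟩
  obtain ⟨e', he'C, he'cl⟩ := (C.comap τ).support.isClosed.exists_closed_singleton hne
  -- `dim 𝒪_{E',e'} = 3`
  have hdimE'e : ringKrullDim (E'.presheaf.stalk e') = (3 : ℕ) := by
    rw [ringKrullDim_stalk_eq_of_isClosed (τ ≫ qE) he'cl, hdimE']
  -- the strict transform morphism `i' : E' ⟶ X'`
  have hτ' : IsBlowup τ ((C.map i).comap i) := by rw [DepthOne.comap_map_centre]; exact hτ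
  set i' : E' ⟶ X' := hσ.strictTransformHom hτ' with hi'
  have hsq : i' ≫ σ = τ ≫ i := hσ.strictTransformHom_comp hτ'
  haveI : IsClosedImmersion i' := hσ.isClosedImmersion_of_comp_eq hτ' hsq
  set x' : X' := i'.base e' with hx'
  -- `x'` lies on the carrier
  have hx'F : x' ∈ ((𝓕).support : Set X') := by
    have h1 : e' ∈ (((𝓕).comap i').support : Set E') := by
      rw [← Scheme.IdealSheafData.comap_comp, hsq, Scheme.IdealSheafData.comap_comp, DepthOne.comap_map_centre]
      exact he'C
    rw [Scheme.IdealSheafData.support_comap, Closeds.coe_preimage] at h1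
    exact h1
  -- `dim 𝒪_{X',x'} ≥ 4`: `𝒪_{E',e'}` is a quotient of `𝒪_{X',x'}/(t)`, `t` a local equation of `σ^*E`
  obtain ⟨b, hb⟩ := Literature.AlgebraicGeometry.Motives.exists_ringKrullDim_eq_nat (X'.presheaf.stalk x')
  have hb4 : 4 ≤ b := by
    -- `σ^*𝓘_E ≤ 𝓘_{E'}` and `σ^*𝓘_E` is effective Cartier
    have hle : i.ker.comap σ ≤ i'.ker := comap_ker_le_ker_strictTransform i σ i' τ hsq
    have hcart : IsEffectiveCartier (i.ker.comap σ) := hiE.comap_of_isBlowup hσ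
    obtain ⟨t, ht, hJt⟩ := hcart.exists_stalkIdeal_eq_span x'
    -- `t ∈ 𝔪_{x'}`: `x' ∈ supp σ^*𝓘_E`
    have hx'E : x' ∈ ((i.ker.comap σ).support : Set X') := by
      have h1 : x' ∈ ((i'.ker.support : Closeds X') : Set X') := by
        have h2 : ((i'.ker.support : Closeds X') : Set X') = closure (Set.range i'.base) := by
          rw [Scheme.Hom.support_ker]
        rw [h2]
        exact subset_closure ⟨e', rfl⟩
      exact Scheme.IdealSheafData.support_antitone hle h1
    have htm : t ∈ IsLocalRing.maximalIdeal (X'.presheaf.stalk x') := by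
      have := (mem_support_iff_stalkIdeal_le _ _).mp hx'E
      rw [hJt] at this
      exact this (Ideal.mem_span_singleton_self t)
    have hquot : ringKrullDim (X'.presheaf.stalk x' ⧸ Ideal.span {t}) + 1 =
        ringKrullDim (X'.presheaf.stalk x') :=
      ringKrullDim_quotient_span_singleton_succ_eq_ringKrullDim_of_mem_nonZeroDivisors ht htm
    -- `dim 𝒪_{E',e'} ≤ dim 𝒪_{X',x'}/(t)`
    have hE'le : ringKrullDim (E'.presheaf.stalk e') ≤
        ringKrullDim (X'.presheaf.stalk x' ⧸ Ideal.span {t}) := by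
      -- `𝒪_{E',e'} ≅ 𝒪_{V(𝓘_{E'}), e'} ≅ 𝒪_{X',x'} / (𝓘_{E'})_{x'}`
      have e1 : ringKrullDim (E'.presheaf.stalk e') =
          ringKrullDim (i'.ker.subscheme.presheaf.stalk (i'.toImage.base e')) :=
        ringKrullDim_eq_of_ringEquiv (asIso (i'.toImage.stalkMap e')).commRingCatIsoToRingEquiv.symm
      have hpt : i'.ker.subschemeι.base (i'.toImage.base e') = x' := by
        show (i'.toImage ≫ i'.imageι).base e' = i'.base e'
        rw [Scheme.Hom.toImage_imageι]
      rw [e1, ringKrullDim_stalk_subscheme, hpt]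
      have hsub : Ideal.span {t} ≤ stalkIdeal i'.ker x' := by rw [← hJt]; exact stalkIdeal_mono hle x'
      exact ringKrullDim_le_of_surjective (Ideal.Quotient.factor hsub) (Ideal.Quotient.factor_surjective hsub)
    rw [hb] at hquot; rw [hdimE'e] at hE'le
    exact nat_succ_le_of_add_one_eq hquot hE'le
  -- the point of `F` under `x'` and `dim 𝒪_{F,x'} ≥ 3`
  obtain ⟨f, hf⟩ : x' ∈ Set.range (𝓕).subschemeι.base := by
    rw [Scheme.IdealSheafData.range_subschemeι]; exact hx'F
  have hF := ringKrullDim_stalk_carrier_add_one i C σ hσ f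
  haveI := isNoetherian_carrier i C σ hσ
  obtain ⟨a, ha⟩ :=
    Literature.AlgebraicGeometry.Motives.exists_ringKrullDim_eq_nat (((𝓕).subscheme).presheaf.stalk f)
  rw [ha, hf, hb] at hF
  have ha3 : 3 ≤ a := by
    have : a + 1 = b := by exact_mod_cast hF
    omega
  calc (3 : WithBot ℕ∞) ≤ (a : WithBot ℕ∞) := by exact_mod_cast ha3
    _ = ringKrullDim (((𝓕).subscheme).presheaf.stalk f) := ha.symm
    _ ≤ topologicalKrullDim (𝓕).subscheme := ringKrullDim_stalk_le_topologicalKrullDim _ f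

end Carrier

end Summit.ResolutionOfSingularities.ResolutionOfSingularities.Theorems.DepthTargets

end
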